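import Literature.Geometry.DiscreteGeometry.ShellCensusReplayEscape
import HarnessLib

/-!
# Soundness of the extended census checker (degree escapes, facet leaf)

Topic `Literature/Geometry/DiscreteGeometry`; part 2 of 3 of the replayer extension
`ShellCensusReplayEscape.lean` (certificate stubs `stub_ffrC5NoOpenStar` / `stub_ffrC5NoFarFacet`
of crux `FiveFoldRationingR`, stmt-AtomisticToContinuum-18071, and request
`defn-ShellTrichotomyReplay` of stmt-18070). One lemma per rule, then the induction, exactly as
in `ShellCensusReplaySound.lean`, whose rule lemmas are reused (`Admissible.comp_perm`,
`Admissible.isometry_comp`, `sat_isometry_comp`, `mem_rootBox`, `good_of_comp_perm`,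
`good_of_isometry_comp`, `fclaim_of_witness`, `fclaim_of_accept`):

* invariance of the new hypotheses: `degOK_comp_perm`, `degOK_isometry_comp` (distances are
  preserved), `facetLE_comp_permOf` (the relabelling fixes the facet labels),
  `facetLE_isometry_comp` (`facetPoly_map` of part 1);
* the rules: `enodeClaim_case`, `eclaim_of_relabel`, `eclaim_of_efclaim_rootBox` (frame),
  `efclaim_split`, `efclaim_of_fclaim` (empty / accept), `eclaim_of_torn` and `eclaim_of_capped`
  (pigeonhole on the bonded-partner set against the decided far partners / bonds),
  `efclaim_of_aboveFacet` (inclusion property `facetPoly_mem_facetIv` of the enclosure);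
* `ETree.check_sound`, `ECensus.checkFrom_sound`, **`ECensus.check_sound`**
  (`ECensus.check P dmin dmax f S C = true → P.EClaim Q dmin dmax f S`) and, for specifications
  without anchors, **`ECensus.infeasible_of_check`** (the entry point of the certificate
  stubs: `infeasible_of_check rfl C (by native_decide) t hadm hdeg hfacet hsat : False`);
  composition across files (`ECensus.claims_append_of_checkFrom`, `Spec.eclaim_of_claims`), and
  the end-to-end toy example.

## References
* R. E. Moore, *Interval Analysis* (1966), Theorem 3.1, §4.4. [cite: Moore1966, Theorem 3.1, §4.4]
-/

noncomputable section

namespace Literature.Geometry.DiscreteGeometry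

open Literature.Analysis.ValidatedNumerics NonemptyInterval Finset
open scoped RealInnerProductSpace

/-- Euclidean `3`-space. -/
local notation "E3" => EuclideanSpace ℝ (Fin 3)

namespace ShellCensus

/-! ### Invariance of the new hypotheses -/

namespace Spec

variable {P : Spec}

/-- The degree window is invariant under relabelling by a permutation. [folklore] -/
theorem degOK_comp_perm {dmin dmax : ℕ} {t : Fin P.n → E3} (h : P.DegOK dmin dmax t)
    (σ : Equiv.Perm (Fin P.n)) : P.DegOK dmin dmax (t ∘ σ) := by
  intro k
  have hmap : (univ.filter fun l => l ≠ k ∧ dist ((t ∘ σ) k) ((t ∘ σ) l) ≤ (P.dhi : ℝ)).map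
      σ.toEmbedding = univ.filter fun l => l ≠ σ k ∧ dist (t (σ k)) (t l) ≤ (P.dhi : ℝ) := by
    ext m
    simp only [mem_map_equiv, mem_filter, mem_univ, true_and, Function.comp_apply,
      Equiv.apply_symm_apply, ne_eq, Equiv.symm_apply_eq]
  have hc : (univ.filter fun l => l ≠ k ∧ dist ((t ∘ σ) k) ((t ∘ σ) l) ≤ (P.dhi : ℝ)).card =
      (univ.filter fun l => l ≠ σ k ∧ dist (t (σ k)) (t l) ≤ (P.dhi : ℝ)).card := by
    rw [← hmap, card_map]
  rw [hc]
  exact h (σ k)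

/-- The degree window is invariant under linear isometries. [folklore] -/
theorem degOK_isometry_comp {dmin dmax : ℕ} {t : Fin P.n → E3} (h : P.DegOK dmin dmax t)
    (A : E3 ≃ₗᵢ[ℝ] E3) : P.DegOK dmin dmax fun k => A (t k) := by
  intro k
  simpa only [LinearIsometryEquiv.dist_map] using h k

/-- The facet condition is invariant under a relabelling fixing the facet labels. [folklore] -/
theorem facetLE_comp_permOf {f : Option (ℕ × ℕ × ℕ)} {π : List ℕ} {t : Fin P.n → E3}
    (hπ : permOK P.n π = true) (hf : fixesB f π = true) (h : P.FacetLE f t) :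
    P.FacetLE f (t ∘ permOf hπ) := by
  match f, hf, h with
  | none, _, _ => trivial
  | some (p, q, r), hf, h =>
    simp only [fixesB, Bool.and_eq_true, beq_iff_eq] at hf
    obtain ⟨⟨hp', hq'⟩, hr'⟩ := hf
    have e : ∀ {m : ℕ} (hm : m < P.n), papp π m = m → permOf hπ ⟨m, hm⟩ = ⟨m, hm⟩ :=
      fun hm hfix => Fin.ext (by rw [permOf_apply_val]; exact hfix)
    intro hp hq hr l
    have h' := h hp hq hr (permOf hπ l)
    simp only [Function.comp_apply, e hp hp', e hq hq', e hr hr']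
    exact h'

/-- The facet condition is invariant under linear isometries. [folklore] -/
theorem facetLE_isometry_comp {f : Option (ℕ × ℕ × ℕ)} {t : Fin P.n → E3} (h : P.FacetLE f t)
    (A : E3 ≃ₗᵢ[ℝ] E3) : P.FacetLE f fun k => A (t k) := by
  match f, h with
  | none, _ => trivial
  | some (p, q, r), h =>
    intro hp hq hr l
    have h' := h hp hq hr l
    rw [← facetPoly_map A] at h'
    exact h'

/-! ### Soundness of the rules -/

/-- The admissibility alternative for the pair `(k, l)`, as constraints. [folklore] -/
theorem sat_case {S : List Constraint} {t : Fin P.n → E3} {k l : ℕ} (hk : k < P.n) (hl : l < P.n)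
    (hkl : k ≠ l) (ht : P.Admissible t) (hS : P.Sat S t) :
    P.Sat ((k, l, true) :: S) t ∨ P.Sat ((k, l, false) :: S) t := by
  rcases ht.dist_alt ⟨k, hk⟩ ⟨l, hl⟩ (fun h => hkl (congrArg Fin.val h)) with h | h
  · exact Or.inl (sat_cons.2 ⟨fun _ _ => ⟨fun _ => h, fun h' => by simp at h'⟩, hS⟩)
  · exact Or.inr (sat_cons.2 ⟨fun _ _ => ⟨fun h' => by simp at h', fun _ => h⟩, hS⟩)

variable {Q : P.Patterns} {dmin dmax : ℕ} {f : Option (ℕ × ℕ × ℕ)}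

/-- **Rule `case`.** [folklore] -/
theorem enodeClaim_case {S : List Constraint} {ob : Option Box} {k l : ℕ} (hk : k < P.n)
    (hl : l < P.n) (hkl : k ≠ l) (hb : P.ENodeClaim Q dmin dmax f ((k, l, true) :: S) ob)
    (hf : P.ENodeClaim Q dmin dmax f ((k, l, false) :: S) ob) : P.ENodeClaim Q dmin dmax f S ob := by
  cases ob with
  | none =>
    intro t ht hdeg hfa hS
    rcases sat_case hk hl hkl ht hS with h | h
    · exact hb t ht hdeg hfa h
    · exact hf t ht hdeg hfa h
  | some B =>
    intro t ht hdeg hfa hS hB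
    rcases sat_case hk hl hkl ht hS with h | h
    · exact hb t ht hdeg hfa h hB
    · exact hf t ht hdeg hfa h hB

/-- **Monotonicity**: more constraints, weaker claim. [folklore] -/
theorem eclaim_mono {S S' : List Constraint} (hsub : ∀ c ∈ S, c ∈ S')
    (h : P.EClaim Q dmin dmax f S) : P.EClaim Q dmin dmax f S' :=
  fun t ht hdeg hfa hS' => h t ht hdeg hfa fun c hc => hS' c (hsub c hc)

/-- **Rule `ref`**: an established claim, relabelled by a permutation fixing the facet labels,
implies every claim with more constraints. [folklore] -/
theorem eclaim_of_relabel {S₀ S : List Constraint} {π : List ℕ} (hπ : permOK P.n π = true)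
    (hfix : fixesB f π = true) (hsub : ∀ c ∈ relabel π S₀, c ∈ S)
    (h0 : P.EClaim Q dmin dmax f S₀) : P.EClaim Q dmin dmax f S := by
  refine eclaim_mono hsub ?_
  intro t ht hdeg hfa hS
  set σ : Equiv.Perm (Fin P.n) := permOf hπ with hσ
  have hgood : P.Good Q (t ∘ σ) := by
    refine h0 (t ∘ σ) (ht.comp_perm σ) (degOK_comp_perm hdeg σ) (facetLE_comp_permOf hπ hfix hfa) ?_
    intro c hc hk hl
    have hmem : (papp π c.1, papp π c.2.1, c.2.2) ∈ relabel π S₀ :=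
      List.mem_map.2 ⟨c, hc, rfl⟩
    have h := hS _ hmem (papp_lt hπ hk) (papp_lt hπ hl)
    simpa [Function.comp, hσ, permOf] using h
  exact good_of_comp_perm σ hgood

/-- **Rule `frame`**: the extended claim of the root box implies the frame-free one (all four
hypotheses and the conclusion are invariant under the normalising isometry). [folklore] -/
theorem eclaim_of_efclaim_rootBox {S : List Constraint} (hP : P.okB = true)
    (h : P.EFClaim Q dmin dmax f S P.rootBox) : P.EClaim Q dmin dmax f S := by
  obtain ⟨-, -, -, -, -, hn⟩ := okB_iff.1 hP
  intro t ht hdeg hfa hS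
  obtain ⟨A, h00, h01, h02, h11, h10, h21⟩ :=
    exists_frame t ⟨0, by omega⟩ ⟨1, by omega⟩ ⟨2, by omega⟩
  have hA := ht.isometry_comp A
  refine good_of_isometry_comp A (h _ hA (degOK_isometry_comp hdeg A)
    (facetLE_isometry_comp hfa A) (sat_isometry_comp hS A) ?_)
  refine mem_rootBox hn hA.norm_hi (hA.norm_lo _) h00 h01 ?_ h11 h10 h21
  rw [h02, A.norm_map]

/-- **Rule `split`.** [folklore] -/
theorem efclaim_split {S : List Constraint} {B : Box} (axis : ℕ) (cut : ℚ)
    (h₁ : P.EFClaim Q dmin dmax f S (B.split axis cut).1)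
    (h₂ : P.EFClaim Q dmin dmax f S (B.split axis cut).2) : P.EFClaim Q dmin dmax f S B := by
  intro t ht hdeg hfa hS hB
  rcases Box.mem_split hB axis cut with h | h
  · exact h₁ t ht hdeg hfa hS h
  · exact h₂ t ht hdeg hfa hS h

/-- A framed claim of `ShellCensusReplay` implies the extended framed claim (rules `empty`,
`accept`). [folklore] -/
theorem efclaim_of_fclaim {S : List Constraint} {B : Box} (h : P.FClaim Q S B) :
    P.EFClaim Q dmin dmax f S B :=
  fun t ht _ _ hS hB => h t ht hS hB

/-- A frame-free extended claim implies the claim of every node with the same constraints. [folklore] -/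
theorem enodeClaim_of_eclaim {S : List Constraint} (h : P.EClaim Q dmin dmax f S) :
    ∀ ob : Option Box, P.ENodeClaim Q dmin dmax f S ob
  | none => h
  | some _ => fun t ht hdeg hfa hS _ => h t ht hdeg hfa hS

/-- **Rule `torn`**: the bonded partners of `k` avoid `k` and the decided far partners
(`far ⇒ dist ≥ gap > dhi`), so they number `≤ n − 1 − #far < dmin`. [folklore] -/
theorem eclaim_of_torn {S : List Constraint} {k : ℕ} (h : P.tornOK dmin S k = true) :
    P.EClaim Q dmin dmax f S := by
  simp only [tornOK, Bool.and_eq_true, decide_eq_true_eq] at h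
  obtain ⟨⟨hk, hgap⟩, hcount⟩ := h
  intro t ht hdeg _ hS
  exfalso
  have hgap' : (P.dhi : ℝ) < P.gap := by exact_mod_cast hgap
  have hdisj : Disjoint (P.farSet S k)
      (univ.filter fun l => l ≠ (⟨k, hk⟩ : Fin P.n) ∧ dist (t ⟨k, hk⟩) (t l) ≤ (P.dhi : ℝ)) := by
    rw [Finset.disjoint_left]
    intro l hl hl'
    simp only [farSet, mem_filter, mem_univ, true_and] at hl
    have hle := (mem_filter.1 hl').2.2
    have hge : (P.gap : ℝ) ≤ dist (t ⟨k, hk⟩) (t l) := by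
      rcases hl.2 with hm | hm
      · simpa using (hS _ hm hk l.2).2 rfl
      · simpa [dist_comm] using (hS _ hm l.2 hk).2 rfl
    linarith
  have hsub : P.farSet S k ∪
      (univ.filter fun l => l ≠ (⟨k, hk⟩ : Fin P.n) ∧ dist (t ⟨k, hk⟩) (t l) ≤ (P.dhi : ℝ)) ⊆
        univ.erase ⟨k, hk⟩ := by
    intro l hl
    rw [mem_erase]
    refine ⟨?_, mem_univ _⟩
    rcases mem_union.1 hl with h | h
    · simp only [farSet, mem_filter, mem_univ, true_and] at h
      exact fun e => h.1 (by rw [e])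
    · exact (mem_filter.1 h).2.1
  have hcard := card_le_card hsub
  rw [card_union_of_disjoint hdisj, card_erase_of_mem (mem_univ _), card_univ,
    Fintype.card_fin] at hcard
  have h1 := (hdeg ⟨k, hk⟩).1
  omega

/-- **Rule `capped`**: the decided bonds at `k` are bonded partners, so they number `≤ dmax`. [folklore] -/
theorem eclaim_of_capped {S : List Constraint} {k : ℕ} (h : P.cappedOK dmax S k = true) :
    P.EClaim Q dmin dmax f S := by
  simp only [cappedOK, Bool.and_eq_true, decide_eq_true_eq] at h
  obtain ⟨hk, hcount⟩ := h
  intro t ht hdeg _ hS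
  exfalso
  have hsub : P.bondSet S k ⊆
      univ.filter fun l => l ≠ (⟨k, hk⟩ : Fin P.n) ∧ dist (t ⟨k, hk⟩) (t l) ≤ (P.dhi : ℝ) := by
    intro l hl
    simp only [bondSet, mem_filter, mem_univ, true_and] at hl
    refine mem_filter.2 ⟨mem_univ _, fun e => hl.1 (by rw [e]), ?_⟩
    rcases hl.2 with hm | hm
    · simpa using (hS _ hm hk l.2).1 rfl
    · simpa [dist_comm] using (hS _ hm l.2 hk).1 rfl
  have h1 := card_le_card hsub
  have h2 := (hdeg ⟨k, hk⟩).2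
  omega

/-- **Rule `aboveFacet`**: a positive interval lower bound of the facet polynomial on the box
contradicts the facet condition. [cite: Moore1966, Theorem 3.1, §4.4] -/
theorem efclaim_of_aboveFacet {S : List Constraint} {B : Box} {l prec : ℕ}
    (h : P.facetOK f B l prec = true) : P.EFClaim Q dmin dmax f S B := by
  match f, h with
  | none, h => simp [facetOK] at h
  | some (p, q, r), h =>
    simp only [facetOK, Bool.and_eq_true, decide_eq_true_eq] at h
    obtain ⟨⟨⟨⟨hp, hq⟩, hr⟩, hl⟩, hpos⟩ := h
    intro t _ _ hfa _ hB
    exfalso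
    have hle : facetPoly (t ⟨p, hp⟩) (t ⟨q, hq⟩) (t ⟨r, hr⟩) (t ⟨l, hl⟩) ≤ 0 := hfa hp hq hr ⟨l, hl⟩
    have hmem : facetPoly (t ⟨p, hp⟩) (t ⟨q, hq⟩) (t ⟨r, hr⟩) (t ⟨l, hl⟩) ∈
        (facetIv prec B p q r l).ratCast ℝ :=
      facetPoly_mem_facetIv hB prec ⟨p, hp⟩ ⟨q, hq⟩ ⟨r, hr⟩ ⟨l, hl⟩
    have hlo := (mem_ratCast_iff.1 hmem).1
    have hpos' : (0 : ℝ) < ((facetIv prec B p q r l).fst : ℚ) := by exact_mod_cast hpos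
    linarith

end Spec

/-! ### Soundness of the checkers -/

/-- **Soundness of the extended tree checker**: with every claim of the context established, an
accepted tree establishes the extended claim of its node. [folklore] -/
theorem ETree.check_sound {P : Spec} (Q : P.Patterns) {dmin dmax : ℕ} {f : Option (ℕ × ℕ × ℕ)}
    (hP : P.okB = true) (ctx : Array (List Constraint))
    (hctx : ∀ (j : ℕ) (hj : j < ctx.size), P.EClaim Q dmin dmax f ctx[j]) :
    ∀ (tr : ETree) (S : List Constraint) (ob : Option Box),
      tr.check P dmin dmax f ctx S ob = true → P.ENodeClaim Q dmin dmax f S ob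
  | .case k l tb tf, S, ob, h => by
    simp only [ETree.check, Bool.and_eq_true, decide_eq_true_eq, Bool.not_eq_true',
      beq_eq_false_iff_ne, ne_eq] at h
    obtain ⟨⟨⟨⟨hk, hl⟩, hkl⟩, hb⟩, hf⟩ := h
    exact Spec.enodeClaim_case hk hl hkl (ETree.check_sound Q hP ctx hctx tb _ _ hb)
      (ETree.check_sound Q hP ctx hctx tf _ _ hf)
  | .ref π j, S, ob, h => by
    simp only [ETree.check] at h
    split at h
    · exact absurd h Bool.false_ne_true
    · rename_i S₀ hS₀
      obtain ⟨hj, rfl⟩ := Array.getElem?_eq_some_iff.1 hS₀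
      simp only [Bool.and_eq_true, List.all_eq_true, decide_eq_true_eq] at h
      exact Spec.enodeClaim_of_eclaim (Spec.eclaim_of_relabel h.1.1 h.1.2 h.2 (hctx j hj)) ob
  | .torn k, S, ob, h => by
    simp only [ETree.check] at h
    exact Spec.enodeClaim_of_eclaim (Spec.eclaim_of_torn h) ob
  | .capped k, S, ob, h => by
    simp only [ETree.check] at h
    exact Spec.enodeClaim_of_eclaim (Spec.eclaim_of_capped h) ob
  | .frame sub, S, none, h =>
    Spec.eclaim_of_efclaim_rootBox hP (ETree.check_sound Q hP ctx hctx sub S (some P.rootBox) h)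
  | .frame _, _, some _, h => absurd h (by simp [ETree.check])
  | .split axis cut lo hi, S, some B, h => by
    simp only [ETree.check, Bool.and_eq_true] at h
    exact Spec.efclaim_split axis cut (ETree.check_sound Q hP ctx hctx lo S _ h.1)
      (ETree.check_sound Q hP ctx hctx hi S _ h.2)
  | .split _ _ _ _, _, none, h => absurd h (by simp [ETree.check])
  | .empty w, S, some B, h => Spec.efclaim_of_fclaim (Spec.fclaim_of_witness hP h)
  | .empty _, _, none, h => absurd h (by simp [ETree.check])
  | .aboveFacet l prec, S, some B, h => Spec.efclaim_of_aboveFacet h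
  | .aboveFacet _ _, _, none, h => absurd h (by simp [ETree.check])
  | .accept pat M σ, S, some B, h => Spec.efclaim_of_fclaim (Spec.fclaim_of_accept hP h)
  | .accept _ _ _, _, none, h => absurd h (by simp [ETree.check])

/-- **Soundness of `ECensus.checkFrom`**: starting from an established context, every entry of
an accepted census is established (also the composition rule across files). [folklore] -/
theorem ECensus.checkFrom_sound {P : Spec} (Q : P.Patterns) {dmin dmax : ℕ}
    {f : Option (ℕ × ℕ × ℕ)} (hP : P.okB = true) :
    ∀ (C : ECensus) (ctx : Array (List Constraint)),
      (∀ (j : ℕ) (hj : j < ctx.size), P.EClaim Q dmin dmax f ctx[j]) →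
      ECensus.checkFrom P dmin dmax f ctx C = true → ∀ e ∈ C, P.EClaim Q dmin dmax f e.1
  | [], _, _, _ => by simp
  | (S, tr) :: rest, ctx, hctx, h => by
    simp only [ECensus.checkFrom, Bool.and_eq_true] at h
    obtain ⟨h1, h2⟩ := h
    have hS : P.EClaim Q dmin dmax f S := ETree.check_sound Q hP ctx hctx tr S none h1
    have hctx' : ∀ (j : ℕ) (hj : j < (ctx.push S).size), P.EClaim Q dmin dmax f (ctx.push S)[j] := by
      intro j hj
      rw [Array.getElem_push]
      split
      · exact hctx j _
      · exact hS
    intro e he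
    rcases List.mem_cons.1 he with rfl | he
    · exact hS
    · exact ECensus.checkFrom_sound Q hP rest (ctx.push S) hctx' h2 e he

/-- **Soundness of the extended census checker**: an accepted census establishes the extended
claim of the target constraint list. [folklore] -/
theorem ECensus.check_sound {P : Spec} (Q : P.Patterns) {dmin dmax : ℕ} {f : Option (ℕ × ℕ × ℕ)}
    {S : List Constraint} (C : ECensus) (h : ECensus.check P dmin dmax f S C = true) :
    P.EClaim Q dmin dmax f S := by
  simp only [ECensus.check, Bool.and_eq_true, List.any_eq_true, decide_eq_true_eq] at h
  obtain ⟨⟨hP, hC⟩, e, he, rfl⟩ := h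
  exact ECensus.checkFrom_sound Q hP C #[] (fun j hj => absurd hj (by simp)) hC e he

/-- **Infeasibility from an accepted census** (specifications without anchors): no admissible
tuple in the degree window satisfies the facet condition and the target constraints — the entry
point for the certificate stubs, `ECensus.infeasible_of_check rfl (ECensus.ofText "<tokens>")
(by native_decide)`. [folklore] -/
theorem ECensus.infeasible_of_check {P : Spec} (hA : P.anchors = []) {dmin dmax : ℕ}
    {f : Option (ℕ × ℕ × ℕ)} {S : List Constraint} (C : ECensus)
    (h : ECensus.check P dmin dmax f S C = true) :
    ∀ t : Fin P.n → E3, P.Admissible t → P.DegOK dmin dmax t → P.FacetLE f t → P.Sat S t → False :=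
  Spec.EClaim.elim_nil hA (ECensus.check_sound (P.emptyPatterns hA) C h)

/-! ### Composition across files -/

/-- The context array of an extended census: its constraint lists, in order. [folklore] -/
def ECensus.ctx (C : ECensus) : Array (List Constraint) := (C.map Prod.fst).toArray

/-- Established entries give an established context. [folklore] -/
theorem ECensus.eclaim_ctx {P : Spec} {Q : P.Patterns} {dmin dmax : ℕ} {f : Option (ℕ × ℕ × ℕ)}
    {C : ECensus} (h : ∀ e ∈ C, P.EClaim Q dmin dmax f e.1) :
    ∀ (j : ℕ) (hj : j < C.ctx.size), P.EClaim Q dmin dmax f C.ctx[j] := by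
  intro j hj
  simp only [ECensus.ctx, List.getElem_toArray, List.getElem_map]
  exact h _ (List.getElem_mem _)

/-- **Composition of certificates**: if the entries of `C₀` are established and `C` checks
against the context `C₀.ctx`, then all entries of `C₀ ++ C` are established. [folklore] -/
theorem ECensus.claims_append_of_checkFrom {P : Spec} (Q : P.Patterns) {dmin dmax : ℕ}
    {f : Option (ℕ × ℕ × ℕ)} (hP : P.okB = true) (C₀ C : ECensus)
    (h₀ : ∀ e ∈ C₀, P.EClaim Q dmin dmax f e.1)
    (h : ECensus.checkFrom P dmin dmax f C₀.ctx C = true) :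
    ∀ e ∈ C₀ ++ C, P.EClaim Q dmin dmax f e.1 := by
  intro e he
  rcases List.mem_append.1 he with he | he
  · exact h₀ e he
  · exact ECensus.checkFrom_sound Q hP C C₀.ctx (ECensus.eclaim_ctx h₀) h e he

/-- The empty census is (vacuously) established — the start of a chain. [folklore] -/
theorem ECensus.claims_nil {P : Spec} (Q : P.Patterns) {dmin dmax : ℕ} {f : Option (ℕ × ℕ × ℕ)} :
    ∀ e ∈ ([] : ECensus), P.EClaim Q dmin dmax f e.1 := by
  simp

/-- Extracting the target claim from established entries. [folklore] -/
theorem Spec.eclaim_of_claims {P : Spec} {Q : P.Patterns} {dmin dmax : ℕ} {f : Option (ℕ × ℕ × ℕ)}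
    {C : ECensus} {S : List Constraint} (h : ∀ e ∈ C, P.EClaim Q dmin dmax f e.1)
    (hS : (C.any fun e => decide (e.1 = S)) = true) : P.EClaim Q dmin dmax f S := by
  obtain ⟨e, he, he'⟩ := List.any_eq_true.1 hS
  rw [decide_eq_true_eq] at he'
  exact he' ▸ h e he

/-- End-to-end on the toy census: no four unit vectors with pairwise distances `≤ 1/10` or
`≥ 3` have exactly two `1/10`-close partners each. -/
example : ∀ t : Fin 4 → E3, toyESpec.Admissible t → toyESpec.DegOK 2 2 t →
    toyESpec.FacetLE none t → toyESpec.Sat [] t → False :=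
  ECensus.infeasible_of_check rfl toyECensus toyECensus_check

end ShellCensus

end Literature.Geometry.DiscreteGeometry

end
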